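import Literature.NumberTheory.EllipticCurves.AnticyclotomicPrimeDecompositionSplitProofs
import Literature.NumberTheory.NumberFields.ArtinMapDecompositionInertia
import Literature.NumberTheory.EllipticCurves.ZpExtensionLocalUnitsOddProofs
import HarnessLib

/-!
# The primes of trivial ring class of conductor `p^{k+1}` split completely in the `k`-th layer of
# the anticyclotomic `ℤ_p`-extension (Perrin-Riou 1987 §3.2; Howard 2004 §3.3; Cox Thm. 7.24 /
# Lemma 15.20) — idelic proof, THEOREMS ONLY

Topic `NumberTheory/EllipticCurves` (Iwasawa theory of `ℤ_p`-extensions); namespace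
`Literature.NumberTheory.EllipticCurves.ZpExtension`.  THEOREMS ONLY (no definition, no named fact,
no instance; D-0026).  Cell `pub/bsd-print-x9`, seat `x10b-p1-w2` (support item
`AnticyclotomicTowerSharp` of the routes PrintX9/PrintX10b: `K_k ⊆ K[p^{k+1}]` at every class
number; this file is its arithmetic core, the assembly is `AnticyclotomicTowerSharpProofs.lean`).

## The statement

Let `K` be imaginary quadratic, `p` an odd prime, `κ : Γ_K ↠ ℤ_p` an anticyclotomic
`ℤ_p`-extension (`ZpExtension.IsAnticyclotomic`) with layers `K_k = κ.layer k`, and let `v ∤ p` be a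
prime of `K` of trivial ring class of conductor `f = p^{k+1}`, i.e. `𝔭_v = (α)` with
`α ≡ n (mod f𝓞_K)` for an integer `n` prime to `p` (Cox §9.A: the primes splitting completely in the
ring class field `K[f]`).  Then `v` splits completely in `K_k`
(`mem_splitPrimes_layer_of_eq_span_of_sub_intCast_mem`).  With Bauer's theorem (tree
`RingClassField.le_of_splitPrimes_laws`) this gives `K_k ⊆ K[p^{k+1}]` (Perrin-Riou 1987 §3.2:
`D_n := H_{p^n} ∩ D_∞ ⊇ K_{n-1}`; Howard 2004 §3.3 under `p ∤ h_K`).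

## The proof (idelic; all class field theory from the tree)

Let `Λ = κ^ab ∘ [·, K] : 𝕀_K → ℤ_p` be the idelic character of `κ`
(`exists_idelicCharacter`).  By the complete splitting theorem in Artin-map form (tree
`mem_splitPrimes_iff_forall_artinIdeleMap_localUnits_eq_one`, Lang XI §4) and the Galois
correspondence for the layer (`absRestrictNormalHom_layer_eq_one_iff`), `v` splits completely in
`K_k` iff `p^k ∣ Λ(⟨z⟩_v)` for every `z ∈ K_vˣ`.  Since `Λ` kills `𝒪_vˣ` (`v ∤ p`,
`idelicCharacter_localUnits_integer`) and `|α|_v = |ϖ_v|`, it suffices that `p^k ∣ Λ(⟨α⟩_v)`.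
The product formula for the principal idele `α` over `{w ∣ p} ∪ {v}`
(`idelicCharacter_prod_localUnits_eq_one`) gives `Λ(⟨α⟩_v) = -∑_{w ∣ p} Λ(⟨α⟩_w)`; at `w ∣ p`
write `α = n · u_w` with `u_w = α/n ∈ 1 + p^{k+1}𝒪_w`.  Then
* `∑_{w ∣ p} Λ(⟨n⟩_w) = 0`: the idele `N = ∏_{w ∣ p} ⟨n⟩_w` of the RATIONAL integer `n` is fixed by
  complex conjugation `c`, while `Λ(c • a) = -Λ(a)` for anticyclotomic `κ` (Neukirch IV (5.8),
  tree `idelicCharacter_smul_eq_inv`), and `ℤ_p` has no `2`-torsion;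
* `Λ(⟨u_w⟩_w) ∈ p^k ℤ_p`: for ODD `p`, `1 + p^{k+1}𝒪_w ⊆ (𝒪_wˣ)^{p^k}` (Neukirch II (5.5); tree
  `PRamified.exists_units_pow_prime_pow_eq_one_add_odd`).

## References

* B. Perrin-Riou, *Fonctions L p-adiques, théorie d'Iwasawa et points de Heegner*, Bull. SMF 115
  (1987), §3.2 (pp. 430–431). [PerrinRiou1987BSMF]
* B. Howard, *The Heegner point Kolyvagin system*, Compos. Math. 140 (2004), §3.3. [Howard2004HeegnerKolyvagin]
* D. A. Cox, *Primes of the form x² + ny²*, 2nd ed. (2013), §7.D Thm. 7.24, §9.A. [Cox2013]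
* J. Neukirch, *Algebraic Number Theory* (1999), Ch. II (5.5), Ch. IV (5.8), Ch. VI (5.6), (6.1),
  Ch. VII (6.13). [NeukirchANT1999]
* S. Lang, *Algebraic Number Theory*, 2nd ed. (1994), Ch. XI §4 Thm. 3–4. [LangANT1994]

## Tree search

`lean search 'ringClassSubgroup .* ≤ .*layerSubgroup'`: only hypotheses (`hTw1`, `StabilizedHeegnerData.layer_le`);
`lean search 'splitPrimes.*layer'`: nothing prior.  Template: `AnticyclotomicPrimeDecompositionSplitProofs`
(Brink 2007 Thm. 2, same idelic currency).
-/

noncomputable section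

open Field NumberField IsDedekindDomain
open scoped Pointwise

namespace Literature.NumberTheory.EllipticCurves.ZpExtension

open Literature.NumberTheory.GaloisRepresentations Literature.NumberTheory.NumberFields
open Literature.NumberTheory.Automorphic Literature.NumberTheory.EllipticCurves.PRamified

variable {K : Type} [Field K] [NumberField K] {p : ℕ} [Fact p.Prime]

/-! ### §1. Local preliminaries -/

omit [NumberField K] [Fact p.Prime] in
/-- An integer prime to `p` is not in a prime `w ∣ p` of `𝓞 K`. [folklore] -/
private theorem intCast_notMem_of_not_dvd [NumberField K] (hp : p.Prime) {w : HeightOneSpectrum (𝓞 K)}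
    (hpw : (p : 𝓞 K) ∈ w.asIdeal) {n : ℤ} (hn : ¬ (p : ℤ) ∣ n) : ((n : ℤ) : 𝓞 K) ∉ w.asIdeal := by
  have hcop : IsCoprime (p : ℤ) n :=
    (Irreducible.coprime_iff_not_dvd (Nat.prime_iff_prime_int.mp hp).irreducible).mpr hn
  obtain ⟨a, b, hab⟩ := hcop
  intro hnw
  have h1 : (1 : 𝓞 K) ∈ w.asIdeal := by
    have := congrArg (fun z : ℤ => (z : 𝓞 K)) hab
    push_cast at this
    rw [← this]
    exact w.asIdeal.add_mem (w.asIdeal.mul_mem_left _ hpw) (w.asIdeal.mul_mem_left _ hnw)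
  exact w.isPrime.ne_top ((Ideal.eq_top_iff_one _).mpr h1)

/-! ### §2. `p^k ∣ Λ(⟨α⟩_v)` for a generator `α ≡ n (mod p^{k+1})` of `𝔭_v`, `v ∤ p` -/

/-- **The heart of `K_k ⊆ K[p^{k+1}]`, idelically.**  `K` imaginary quadratic, `p` odd, `κ`
anticyclotomic with idelic character `Λ`; `v ∤ p` with `𝔭_v = (α)`, `α ≡ n (mod p^{k+1}𝓞_K)`,
`p ∤ n`.  Then `p^k ∣ Λ(⟨α⟩_v)` (additively in `ℤ_p`).  Proof: module docstring (product formula over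
`{w ∣ p} ∪ {v}`; at `w ∣ p`, `α = n · u_w`, the `n`-part dies by the anticyclotomic sign, the
`u_w ∈ 1 + p^{k+1}𝒪_w` part is a `p^k`-th power for odd `p`).
[cite: PerrinRiou1987BSMF, §3.2 (pp. 430–431)] [cite: NeukirchANT1999, Ch. VII §6 Prop. (6.13), Ch. IV §5 (5.8), Ch. II §5 (5.5)] -/
theorem prime_pow_dvd_toAdd_idelicCharacter_localUnits_generator (hK : IsImaginaryQuadratic K)
    (hp2 : p ≠ 2) (κ : ZpExtension K p) (hκ : κ.IsAnticyclotomic)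
    {Λ : ideleGroup K →ₜ* Multiplicative ℤ_[p]}
    (hΛ : ∀ (a : ideleGroup K) (γ : absoluteGaloisGroup K),
      absGaloisAbProj K γ = ideleArtinMap K a → Λ a = κ.toContinuousMonoidHom γ)
    (k : ℕ) {v : HeightOneSpectrum (𝓞 K)} (hpv : (p : 𝓞 K) ∉ v.asIdeal)
    {α : 𝓞 K} (hα : v.asIdeal = Ideal.span {α}) {n : ℤ} (hn : ¬ (p : ℤ) ∣ n)
    (hαn : α - (n : 𝓞 K) ∈ Ideal.span {((p : 𝓞 K)) ^ (k + 1)}) (hα0 : (α : K) ≠ 0) :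
    (p : ℤ_[p]) ^ k ∣ (Λ (localUnits v (globalToLocalUnits v (Units.mk0 (α : K) hα0)))).toAdd := by
  classical
  have hp : p.Prime := Fact.out
  haveI : IsTotallyComplex K := hK.2
  haveI : Algebra.IsQuadraticExtension ℚ K := ⟨hK.1⟩
  haveI : IsGalois ℚ K := inferInstance
  -- the non-trivial automorphism `c = ḡ` of `K`, from `g ∈ Γ_ℚ ∖ res(Γ_K)`; `Λ(c • a) = (Λ a)⁻¹`
  obtain ⟨g, hg, -⟩ := exists_not_mem_range_absGaloisRestrict K (Rat.castHom ℝ)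
    (fun w => IsTotallyComplex.isComplex w)
  set c : K ≃ₐ[ℚ] K := absGaloisQuot ℚ K g with hcdef
  have hΛc : ∀ a : ideleGroup K, Λ (c • a) = (Λ a)⁻¹ := fun a =>
    idelicCharacter_smul_eq_inv hΛ g (fun σ τ hτ => hκ σ τ g hg hτ) a
  -- the global elements `α`, `n` as units of `K`
  set αK : Kˣ := Units.mk0 (α : K) hα0 with hαKdef
  have hn0 : (n : K) ≠ 0 := by
    have : n ≠ 0 := by rintro rfl; exact hn (dvd_zero _)
    exact_mod_cast this
  set nK : Kˣ := Units.mk0 (n : K) hn0 with hnKdef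
  have hαpow : v.asIdeal ^ 1 = Ideal.span {α} := by rw [pow_one]; exact hα
  -- the places above `p`
  haveI : Finite (placesAbove K p) := finite_placesAbove
  haveI : Fintype (placesAbove K p) := Fintype.ofFinite _
  set S : Finset (HeightOneSpectrum (𝓞 K)) :=
    Finset.univ.image (fun w : placesAbove K p => (w.1 : HeightOneSpectrum (𝓞 K))) with hSdef
  have hS : ∀ w : HeightOneSpectrum (𝓞 K), w ∈ S ↔ (p : 𝓞 K) ∈ w.asIdeal := by
    intro w
    rw [hSdef, Finset.mem_image]
    constructor
    · rintro ⟨w', -, rfl⟩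
      exact w'.2
    · intro hw
      exact ⟨⟨w, hw⟩, Finset.mem_univ _, rfl⟩
  have hvS : v ∉ S := fun h => hpv ((hS v).mp h)
  have hcS : ∀ w, w ∈ S ↔ c • w ∈ S := by
    intro w
    rw [hS, hS]
    have h1 := HeightOneSpectrum.smul_mem_smul_asIdeal_iff c w ((p : ℕ) : 𝓞 K)
    rw [show c • ((p : ℕ) : 𝓞 K) = (p : 𝓞 K) from map_natCast (MulSemiringAction.toRingHom _ _ c) p]
      at h1
    exact h1.symm
  -- (1) the product formula for `α` over `{v} ∪ S`
  have hprod : Λ (localUnits v (globalToLocalUnits v αK)) *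
      ∏ w ∈ S, Λ (localUnits w (globalToLocalUnits w αK)) = 1 := by
    have hout : ∀ w ∉ insert v S, w.valuation K (αK : K) = 1 := by
      intro w hw
      rw [Finset.mem_insert, not_or] at hw
      rw [hαKdef, Units.val_mk0]
      exact valuation_eq_one_of_pow_asIdeal_eq_span hαpow hw.1
    have h1 := idelicCharacter_prod_localUnits_eq_one κ hΛ (insert v S)
      (fun w hw => Finset.mem_insert_of_mem ((hS w).mpr hw)) αK hout
    rwa [Finset.prod_insert hvS] at h1
  -- (2) the idele `N = ∏_{w ∣ p} ⟨n⟩_w` of the rational integer `n` is killed by `Λ`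
  set N : ideleGroup K := ∏ w ∈ S, localUnits w (globalToLocalUnits w nK) with hNdef
  have hcN : c • N = N := by
    rw [hNdef, smul_prod_localUnits_globalToLocalUnits c S hcS nK]
    refine Finset.prod_congr rfl fun w _ => ?_
    congr 2
    ext
    rw [Units.coe_map, hnKdef, Units.val_mk0]
    exact map_intCast (c : K →+* K) n
  have hΛN : (Λ N).toAdd = 0 := by
    have h1 : Λ N = (Λ N)⁻¹ := by
      conv_lhs => rw [← hcN]
      exact hΛc N
    have h2 : (Λ N).toAdd + (Λ N).toAdd = 0 := by
      rw [← toAdd_mul, eq_inv_iff_mul_eq_one.mp h1, toAdd_one]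
    exact add_self_eq_zero.mp h2
  -- (3) at `w ∣ p`: `α = n · u_w` with `u_w ∈ 1 + p^{k+1}𝒪_w` a `p^k`-th power (`p` odd)
  obtain ⟨β, hβ⟩ := Ideal.mem_span_singleton'.mp hαn
  have hαnβ : (α : K) = n + (p : K) ^ (k + 1) * (β : K) := by
    have h' : α = (n : 𝓞 K) + (p : 𝓞 K) ^ (k + 1) * β := by linear_combination -hβ
    have h := congrArg (algebraMap (𝓞 K) K) h'
    rw [map_add, map_mul, map_pow, map_natCast, map_intCast] at h
    exact h
  have hKid : (n : K)⁻¹ * (α : K) = 1 + (p : K) ^ (k + 1) * ((β : K) / (n : K)) := by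
    rw [hαnβ]
    field_simp
  have hstep : ∀ w ∈ S, ∃ t : ℤ_[p],
      (Λ (localUnits w (globalToLocalUnits w αK))).toAdd =
        (Λ (localUnits w (globalToLocalUnits w nK))).toAdd + (p : ℤ_[p]) ^ k * t := by
    intro w hwS
    have hw : (p : 𝓞 K) ∈ w.asIdeal := (hS w).mp hwS
    -- `β / n ∈ 𝒪_w`
    have hnw : w.valuation K ((n : ℤ) : K) = 1 := by
      have h := (HeightOneSpectrum.valuation_eq_one_iff_notMem (K := K) (v := w)).2
        (intCast_notMem_of_not_dvd hp hw hn)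
      simpa using h
    have hle : w.valuation K ((β : K) / (n : K)) ≤ 1 := by
      rw [map_div₀, hnw, div_one]
      exact HeightOneSpectrum.valuation_le_one w β
    set x : w.adicCompletionIntegers K := ⟨algebraMap K (w.adicCompletion K) ((β : K) / (n : K)), by
      rw [HeightOneSpectrum.mem_adicCompletionIntegers,
        GaloisRepresentations.valued_algebraMap_adicCompletion]; exact hle⟩
      with hxdef
    have hx : ((x : w.adicCompletionIntegers K) : w.adicCompletion K) =
        algebraMap K (w.adicCompletion K) ((β : K) / (n : K)) := rfl
    -- the principal unit `u_w = 1 + p^{k+1} x` and its `p^k`-th root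
    obtain ⟨u, -, hu⟩ := exists_units_pow_prime_pow_eq_one_add_odd (hp.odd_of_ne_two hp2) w hw k x
    have hmap : Units.map ((w.adicCompletionIntegers K).subtype : _ →* _) (u ^ p ^ k) =
        globalToLocalUnits w (nK⁻¹ * αK) := by
      ext
      have hcoe : ((Units.map ((w.adicCompletionIntegers K).subtype : _ →* _) (u ^ p ^ k) :
          (w.adicCompletion K)ˣ) : w.adicCompletion K) =
          (((u ^ p ^ k : (w.adicCompletionIntegers K)ˣ) : w.adicCompletionIntegers K) :
            w.adicCompletion K) := rfl
      rw [hcoe, hu, val_globalToLocalUnits, Units.val_mul, Units.val_inv_eq_inv_val,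
        hαKdef, hnKdef, Units.val_mk0, Units.val_mk0, hKid, map_add, map_one, map_mul, map_pow,
        map_natCast, ← hx]
      have hpc : (((p : w.adicCompletionIntegers K)) : w.adicCompletion K) = p :=
        map_natCast (w.adicCompletionIntegers K).subtype p
      rw [AddMemClass.coe_add, OneMemClass.coe_one, MulMemClass.coe_mul, SubmonoidClass.coe_pow, hpc]
    have hαeq : globalToLocalUnits w αK =
        globalToLocalUnits w nK * Units.map ((w.adicCompletionIntegers K).subtype : _ →* _) (u ^ p ^ k) := by
      rw [hmap, ← map_mul, mul_inv_cancel_left]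
    refine ⟨(Λ (localUnits w (Units.map ((w.adicCompletionIntegers K).subtype : _ →* _) u))).toAdd, ?_⟩
    rw [hαeq, map_mul, map_mul, toAdd_mul, map_pow, map_pow, map_pow, toAdd_pow, nsmul_eq_mul,
      Nat.cast_pow]
  -- (4) sum over `w ∣ p` and conclude with the product formula
  choose! t ht using hstep
  have hsum : (∏ w ∈ S, Λ (localUnits w (globalToLocalUnits w αK))).toAdd =
      (p : ℤ_[p]) ^ k * ∑ w ∈ S, t w := by
    rw [toAdd_prod, Finset.sum_congr rfl ht, Finset.sum_add_distrib, ← Finset.mul_sum, ← toAdd_prod,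
      ← map_prod, ← hNdef, hΛN, zero_add]
  have hv : (Λ (localUnits v (globalToLocalUnits v αK))).toAdd = -((p : ℤ_[p]) ^ k * ∑ w ∈ S, t w) := by
    have h := congrArg Multiplicative.toAdd hprod
    rw [toAdd_mul, toAdd_one, hsum] at h
    linear_combination h
  rw [hv]
  exact (Dvd.intro _ rfl).neg_right

/-- **`p^k ∣ Λ(⟨z⟩_v)` for every `z ∈ K_vˣ`** (same hypotheses): `K_vˣ = α_v^ℤ · 𝒪_vˣ` with
`|α|_v = |ϖ_v|`, and `Λ` kills `𝒪_vˣ` at `v ∤ p` (the layers are unramified off `p`).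
[cite: Washington1997, §13.1 Prop. 13.2] [cite: PerrinRiou1987BSMF, §3.2 (pp. 430–431)] -/
theorem prime_pow_dvd_toAdd_idelicCharacter_localUnits (hK : IsImaginaryQuadratic K)
    (hp2 : p ≠ 2) (κ : ZpExtension K p) (hκ : κ.IsAnticyclotomic)
    {Λ : ideleGroup K →ₜ* Multiplicative ℤ_[p]}
    (hΛ : ∀ (a : ideleGroup K) (γ : absoluteGaloisGroup K),
      absGaloisAbProj K γ = ideleArtinMap K a → Λ a = κ.toContinuousMonoidHom γ)
    (k : ℕ) {v : HeightOneSpectrum (𝓞 K)} (hpv : (p : 𝓞 K) ∉ v.asIdeal)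
    {α : 𝓞 K} (hα : v.asIdeal = Ideal.span {α}) {n : ℤ} (hn : ¬ (p : ℤ) ∣ n)
    (hαn : α - (n : 𝓞 K) ∈ Ideal.span {((p : 𝓞 K)) ^ (k + 1)}) (z : (v.adicCompletion K)ˣ) :
    (p : ℤ_[p]) ^ k ∣ (Λ (localUnits v z)).toAdd := by
  have hα0' : α ≠ 0 := by
    intro h
    rw [h, Ideal.span_singleton_eq_bot.mpr rfl] at hα
    exact v.ne_bot hα
  have hα0 : (α : K) ≠ 0 := fun h => hα0' (RingOfIntegers.coe_eq_zero_iff.mp h)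
  have hgen := prime_pow_dvd_toAdd_idelicCharacter_localUnits_generator hK hp2 κ hκ hΛ k hpv hα hn
    hαn hα0
  set αv : (v.adicCompletion K)ˣ := globalToLocalUnits v (Units.mk0 (α : K) hα0) with hαvdef
  -- `|α|_v = exp(-1)`, `|z|_v = exp m`
  have hvα : Valued.v (αv : v.adicCompletion K) = WithZero.exp (-1 : ℤ) := by
    rw [hαvdef, val_globalToLocalUnits, Units.val_mk0]
    have h := valued_eq_exp_neg_of_pow_asIdeal_eq_span hα0' (h := 1) (by rw [pow_one]; exact hα)
    simpa using h
  have hz0 : Valued.v (z : v.adicCompletion K) ≠ 0 := (Valuation.ne_zero_iff _).mpr z.ne_zero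
  set m : ℤ := WithZero.log (Valued.v (z : v.adicCompletion K)) with hm
  have hvz : Valued.v (z : v.adicCompletion K) = WithZero.exp m := (WithZero.exp_log hz0).symm
  -- `u = z · α_v^m` is a local unit
  set u : (v.adicCompletion K)ˣ := z * αv ^ m with hudef
  have hvu : Valued.v (u : v.adicCompletion K) = 1 := by
    rw [hudef, Units.val_mul, Units.val_zpow_eq_zpow_val, map_mul, map_zpow₀, hvz, hvα,
      ← WithZero.exp_zsmul, ← WithZero.exp_add, smul_eq_mul, mul_neg_one, add_neg_cancel,
      WithZero.exp_zero]
  obtain ⟨u', hu'⟩ := IdelicCharacter.exists_unitsMap_eq_of_valued_eq_one _ hvu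
  have hΛu : Λ (localUnits v u) = 1 := by
    rw [← hu']
    exact idelicCharacter_localUnits_integer κ hΛ hpv u'
  have hz : z = u * αv ^ (-m) := by rw [hudef, zpow_neg, mul_inv_cancel_right]
  rw [hz, map_mul, map_mul, hΛu, one_mul, map_zpow, map_zpow, toAdd_zpow, zsmul_eq_mul]
  exact hgen.mul_left _

/-! ### §3. The primes of trivial ring class split completely in the layer `K_k` -/

/-- **`v` splits completely in `K_k`** — `K` imaginary quadratic, `p` odd, `κ` anticyclotomic,
`v ∤ p`, `𝔭_v = (α)` with `α ≡ n (mod p^{k+1}𝓞_K)`, `p ∤ n` (i.e. `[𝔭_v] = 1` in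
`I_K(p^{k+1})/P_{K,ℤ}(p^{k+1})`).  By the complete splitting theorem (Artin-map form,
`mem_splitPrimes_iff_forall_artinIdeleMap_localUnits_eq_one`): `ψ_{K_k|K}(⟨z⟩_v) = γ|_{K_k}` for a
representative `γ` of `[⟨z⟩_v, K]`, which is trivial iff `γ ∈ κ⁻¹(p^kℤ_p)` iff `p^k ∣ Λ(⟨z⟩_v)`.
[cite: PerrinRiou1987BSMF, §3.2 (pp. 430–431)] [cite: Howard2004HeegnerKolyvagin, §3.3]
[cite: LangANT1994, Ch. XI §4 Thm. 3–4] -/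
theorem mem_splitPrimes_layer_of_eq_span_of_sub_intCast_mem (hK : IsImaginaryQuadratic K)
    (hp2 : p ≠ 2) (κ : ZpExtension K p) (hκ : κ.IsAnticyclotomic) (k : ℕ)
    {v : HeightOneSpectrum (𝓞 K)} (hpv : (p : 𝓞 K) ∉ v.asIdeal)
    {α : 𝓞 K} (hα : v.asIdeal = Ideal.span {α}) {n : ℤ} (hn : ¬ (p : ℤ) ∣ n)
    (hαn : α - (n : 𝓞 K) ∈ Ideal.span {((p : 𝓞 K)) ^ (k + 1)}) :
    haveI : FiniteDimensional K (κ.layer k) := κ.finiteDimensional_layer_holds k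
    haveI : NumberField (κ.layer k) := NumberField.of_module_finite K (κ.layer k)
    v ∈ splitPrimes K (κ.layer k) := by
  haveI : FiniteDimensional K (κ.layer k) := κ.finiteDimensional_layer_holds k
  haveI : IsGalois K (κ.layer k) := κ.isGalois_layer_holds k
  haveI : IsAbelianGalois K (κ.layer k) := κ.isAbelianGalois_layer k
  haveI : NumberField (κ.layer k) := NumberField.of_module_finite K (κ.layer k)
  obtain ⟨Λ, hΛ⟩ := exists_idelicCharacter κ.toContinuousMonoidHom
  rw [mem_splitPrimes_iff_forall_artinIdeleMap_localUnits_eq_one]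
  intro z
  obtain ⟨γ, hγ, hΛz⟩ := idelicCharacter_exists_eq hΛ (localUnits v z)
  rw [← absRestrictNormalHom_eq_artinIdeleMap_of_eq (κ.layer k) hγ,
    κ.absRestrictNormalHom_layer_eq_one_iff k, mem_layerSubgroup]
  have h := prime_pow_dvd_toAdd_idelicCharacter_localUnits hK hp2 κ hκ hΛ k hpv hα hn hαn z
  rwa [hΛz] at h

end Literature.NumberTheory.EllipticCurves.ZpExtension

end
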